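import Summits.HodgeConjecture.HodgeConjecture.Theorems.R90S4TwistedTraceSetLine

/-!
# R90-TF · S4 · THEOREMS — `R90S4TwistedCharLiftLemmas`: the API of the STEP-1 lift predicate `IsTwistedCharLiftWith`

R90-TF section S4 = [Rogawski1990] Ch. 13.1–13.2 (dealer K2E2-plan (g6)); crux H413 (`stmt-HodgeConjecture-24833`), route `HCCMUnconditional`;
item S4#C-LIFT (K2E3-p21 (g9)).  Lemmas about FILE C's ★ `IsTwistedCharLiftWith Φ T𝔯 𝔩 νG νG̃ P π̃` (★ `Theorems/R90S4LocalBaseChangeDefs` §3):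
«`π̃ ∈ E_ε(G̃_v)` is a lift of `Π`» in the sense of STEP 1 of §13.2 p. 200 — `π̃ ∈ E_ε(G̃_v)` and SOME twisted character `T` of `π̃` along SOME
realisation `e` of `ε_v` satisfies `T φ = χ_Π(f)` whenever `φ`, `f` are smooth and `φ → f` (`T𝔯 φ f`).

* §1 projections and monotonicity: `.isEpsClassAt`, `.isAdmissible`, `.mono` (the predicate is ANTITONE in the transfer relation `T𝔯`),
  `isTwistedCharLiftWith_congr_rel` (two relations that agree on smooth pairs give the same predicate).
* §2 the REALISATION-FREE form for hermitian `Φ` (★ K2E3-p27 `cmTwistLocalEquiv` is THE realisation, ★ K2E3-p14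
  `isEpsRealisation_iff_eq_cmTwistLocalEquiv`): `isTwistedCharLiftWith_iff_cmTwistLocalEquiv`, and the constructor `isTwistedCharLiftWith_of_mem`.
* §3 UNIQUENESS OF «THE CHOICE OF `π̃(ε)`» (p. 200 «there is a choice of `π̃(ε)` such that …»): if some smooth pair `φ₀ → f₀` has `χ_Π(f₀) ≠ 0`,
  the twisted character `T` in the lift identity is UNIQUE (`IsTwistedCharLiftWith.existsUnique_of_ne_zero`; Schur rigidity ★
  `eq_of_mem_of_apply_eq` of `R90S4TwistedTraceSetLine`), and the whole `twistedTraceSet` is the punctured line through it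
  (`IsTwistedCharLiftWith.exists_line`, ★ `twistedTraceSet_eq_image_smul`); any other member satisfies the identity up to ONE
  non-zero scalar (`IsTwistedCharLiftWith.exists_smul_of_mem`).

ZERO `sorry`; ★-only imports (★ `R90S4TwistedTraceSetLine` p862006, which brings ★ p861699 ∕ p861769 ∕ p861794 ∕ p861703); no `Cruxes/…` import.

## References
* [Rogawski1990] J. D. Rogawski, *Automorphic Representations of Unitary Groups in Three Variables*, Ann. of Math. Stud. 123 (1990),
  §13.2 p. 200 (STEP 1 of the lift `ψ_G`, «a choice of `π̃(ε)`»), §12.4 pp. 180–181 (`E_ε(G̃)`, `ε(π̃) ≅ π̃`), §4.10 p. 57 (`χ_{π̃ε}`, `φ → f`).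
* [Bump1997] D. Bump, *Automorphic Forms and Representations*, CUP (1997), Prop. 4.2.4 p. 428 (Schur's lemma for admissible representations).
-/

set_option autoImplicit false
-- the mandated namespace repeats the single-problem summit's segment (`HodgeConjecture.HodgeConjecture`)
set_option linter.dupNamespace false

noncomputable section

open MeasureTheory
open scoped NumberField Matrix
open Literature.NumberTheory.Rogawski1990 (IsLocSmooth)

namespace Summit.HodgeConjecture.HodgeConjecture.R90.S4

open Literature.NumberTheory.Automorphic
open IsDedekindDomain NumberField
open Summit.HodgeConjecture.HodgeConjecture.Cruxes.H413.F0P3LocalPacketKit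

variable {L : Type} [Field L] [NumberField L] [IsCMField L] {Φ : GL (Fin 3) L}
  {v : HeightOneSpectrum (𝓞 ↥(maximalRealSubfield L))}
  [MeasurableSpace (GtLoc L v)]
  [MeasurableSpace ((UnitaryGroup.cmDatum L 3 (Φ : Matrix (Fin 3) (Fin 3) L)).Local v)]
  {T𝔯 T𝔯' : (GtLoc L v → ℂ) → ((UnitaryGroup.cmDatum L 3 (Φ : Matrix (Fin 3) (Fin 3) L)).Local v → ℂ) → Prop}
  {𝔩 : LocalPacketKit L (Φ : Matrix (Fin 3) (Fin 3) L) v}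
  {νG : Measure ((UnitaryGroup.cmDatum L 3 (Φ : Matrix (Fin 3) (Fin 3) L)).Local v)} {νGt : Measure (GtLoc L v)}
  {P : 𝔩.Pkt} {πt : IrrClass (GtLoc L v)}

/-! ## §1 Projections; monotonicity in the transfer relation -/

/-- A lift is a member of `E_ε(G̃_v)`. [cite: Rogawski1990, §13.2 p. 200; §12.4 p. 180] -/
theorem IsTwistedCharLiftWith.isEpsClassAt (h : IsTwistedCharLiftWith Φ T𝔯 𝔩 νG νGt P πt) : IsEpsClassAt L Φ v πt := h.1

/-- A lift is admissible. [cite: Rogawski1990, §12.4 p. 180] -/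
theorem IsTwistedCharLiftWith.isAdmissible (h : IsTwistedCharLiftWith Φ T𝔯 𝔩 νG νGt P πt) : πt.IsAdmissible :=
  h.1.isAdmissible

/-- A lift is `ε`-fixed. [cite: Rogawski1990, §12.4 p. 180] -/
theorem IsTwistedCharLiftWith.isEpsFixedAt (h : IsTwistedCharLiftWith Φ T𝔯 𝔩 νG νGt P πt) : IsEpsFixedAt L Φ v πt :=
  h.1.isEpsFixedAt

/-- **The lift predicate is ANTITONE in the transfer relation**: if `T𝔯′ ⊆ T𝔯` (every `T𝔯′`-pair is a `T𝔯`-pair) then a lift against `T𝔯`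
is a lift against `T𝔯′` (fewer identities to satisfy).  ED. 2 of FILE C fixes `T𝔯` to the transfer of record; this lemma moves results
between a relation and its restrictions. [cite: Rogawski1990, §13.2 p. 200; §4.10 p. 57] -/
theorem IsTwistedCharLiftWith.mono (hle : ∀ φ f, T𝔯' φ f → T𝔯 φ f) (h : IsTwistedCharLiftWith Φ T𝔯 𝔩 νG νGt P πt) :
    IsTwistedCharLiftWith Φ T𝔯' 𝔩 νG νGt P πt := by
  obtain ⟨hcls, e, he, T, hT, hid⟩ := h
  exact ⟨hcls, e, he, T, hT, fun φ f hφ hf hr => hid φ f hφ hf (hle φ f hr)⟩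

/-- Two transfer relations that AGREE ON SMOOTH PAIRS define the same lift predicate (the identity is only demanded at smooth `φ`, `f`).
[cite: Rogawski1990, §13.2 p. 200; §4.10 p. 57] -/
theorem isTwistedCharLiftWith_congr_rel (hiff : ∀ φ f, IsLocSmooth φ → IsLocSmooth f → (T𝔯 φ f ↔ T𝔯' φ f)) :
    IsTwistedCharLiftWith Φ T𝔯 𝔩 νG νGt P πt ↔ IsTwistedCharLiftWith Φ T𝔯' 𝔩 νG νGt P πt := by
  constructor
  · rintro ⟨hcls, e, he, T, hT, hid⟩
    exact ⟨hcls, e, he, T, hT, fun φ f hφ hf hr => hid φ f hφ hf ((hiff φ f hφ hf).2 hr)⟩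
  · rintro ⟨hcls, e, he, T, hT, hid⟩
    exact ⟨hcls, e, he, T, hT, fun φ f hφ hf hr => hid φ f hφ hf ((hiff φ f hφ hf).1 hr)⟩

/-! ## §2 The realisation-free form (hermitian `Φ`: `e = cmTwistLocalEquiv`) -/

section Hermitian

variable (hΦ : ((Φ : GL (Fin 3) L) : Matrix (Fin 3) (Fin 3) L)ᵀ.map (IsCMField.complexConj L) = (Φ : Matrix (Fin 3) (Fin 3) L))

/-- **Realisation-free form of the lift predicate** for hermitian `Φ`: the `∃ e, IsEpsRealisation e ∧ …` of ★ `IsTwistedCharLiftWith` is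
witnessed by, and only by, THE realisation ★ `cmTwistLocalEquiv L 3 Φ hΦ v` (★ `isEpsRealisation_iff_eq_cmTwistLocalEquiv`), so
`π̃` is a lift of `Π` iff `π̃ ∈ E_ε(G̃_v)` and some `T ∈ twistedTraceSet π̃ νG̃ (cmTwistLocalEquiv …)` satisfies `T φ = χ_Π(f)` on smooth
`T𝔯`-pairs. [cite: Rogawski1990, §13.2 p. 200; §12.4 pp. 180–181] -/
theorem isTwistedCharLiftWith_iff_cmTwistLocalEquiv :
    IsTwistedCharLiftWith Φ T𝔯 𝔩 νG νGt P πt ↔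
      IsEpsClassAt L Φ v πt ∧ ∃ T ∈ twistedTraceSet πt νGt (cmTwistLocalEquiv L 3 Φ hΦ v),
        ∀ φ f, IsLocSmooth φ → IsLocSmooth f → T𝔯 φ f → T φ = chiPacket 𝔩 νG P f := by
  constructor
  · rintro ⟨hcls, e, he, hT⟩
    rw [(isEpsRealisation_iff_eq_cmTwistLocalEquiv L Φ hΦ v e).1 he] at hT
    exact ⟨hcls, hT⟩
  · rintro ⟨hcls, hT⟩
    exact ⟨hcls, cmTwistLocalEquiv L 3 Φ hΦ v, isEpsRealisation_cmTwistLocalEquiv L Φ hΦ v, hT⟩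

/-- **Constructor**: a member `π̃ ∈ E_ε(G̃_v)` with a twisted character `T` along `cmTwistLocalEquiv` satisfying the identity on smooth
`T𝔯`-pairs is a lift. [cite: Rogawski1990, §13.2 p. 200] -/
theorem isTwistedCharLiftWith_of_mem (hcls : IsEpsClassAt L Φ v πt) {T : (GtLoc L v → ℂ) → ℂ}
    (hT : T ∈ twistedTraceSet πt νGt (cmTwistLocalEquiv L 3 Φ hΦ v))
    (hid : ∀ φ f, IsLocSmooth φ → IsLocSmooth f → T𝔯 φ f → T φ = chiPacket 𝔩 νG P f) :
    IsTwistedCharLiftWith Φ T𝔯 𝔩 νG νGt P πt :=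
  (isTwistedCharLiftWith_iff_cmTwistLocalEquiv hΦ).2 ⟨hcls, T, hT, hid⟩

/-! ## §3 Uniqueness of «the choice of `π̃(ε)`» -/

/-- **«The choice of `π̃(ε)`» in STEP 1 is UNIQUE as soon as one matched value is non-zero.**  Let `π̃` be a lift of `Π` (hermitian `Φ`;
`G̃_v` with a compact open subgroup `K`).  If some smooth pair `φ₀ → f₀` has `χ_Π(f₀) ≠ 0`, then there is EXACTLY ONE
`T ∈ twistedTraceSet π̃ νG̃ (cmTwistLocalEquiv …)` with `T φ = χ_Π(f)` on all smooth `T𝔯`-pairs: any two candidates lie on one punctured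
line (Schur, ★ `twistedTraceSet_pairwise_smul`; `π̃` is admissible as a member of `E_ε`) and agree at `φ₀` where they do not vanish
(★ `eq_of_mem_of_apply_eq`). [cite: Rogawski1990, §13.2 p. 200; §4.10 p. 57] [cite: Bump1997, Prop. 4.2.4 p. 428] -/
theorem IsTwistedCharLiftWith.existsUnique_of_ne_zero (h : IsTwistedCharLiftWith Φ T𝔯 𝔩 νG νGt P πt)
    {K : Subgroup (GtLoc L v)} (hKo : IsOpen (K : Set (GtLoc L v))) (hKc : IsCompact (K : Set (GtLoc L v)))
    (hex : ∃ φ₀ f₀, IsLocSmooth φ₀ ∧ IsLocSmooth f₀ ∧ T𝔯 φ₀ f₀ ∧ chiPacket 𝔩 νG P f₀ ≠ 0) :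
    ∃! T : (GtLoc L v → ℂ) → ℂ, T ∈ twistedTraceSet πt νGt (cmTwistLocalEquiv L 3 Φ hΦ v) ∧
      ∀ φ f, IsLocSmooth φ → IsLocSmooth f → T𝔯 φ f → T φ = chiPacket 𝔩 νG P f := by
  obtain ⟨hcls, T, hT, hid⟩ := (isTwistedCharLiftWith_iff_cmTwistLocalEquiv hΦ).1 h
  obtain ⟨φ₀, f₀, hφ₀, hf₀, hr₀, hne⟩ := hex
  refine ⟨T, ⟨hT, hid⟩, fun T' hT' => ?_⟩
  have hTφ₀ : T φ₀ = chiPacket 𝔩 νG P f₀ := hid φ₀ f₀ hφ₀ hf₀ hr₀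
  refine eq_of_mem_of_apply_eq hcls.isAdmissible hKo hKc hT hT'.1 (φ := φ₀) ?_ ?_
  · rw [hT'.2 φ₀ f₀ hφ₀ hf₀ hr₀, hTφ₀]
  · rw [hTφ₀]; exact hne

/-- **All twisted characters of a lift lie on the line through the matched one.**  Under the hypotheses of
`existsUnique_of_ne_zero`, `twistedTraceSet π̃ νG̃ (cmTwistLocalEquiv …) = {c • T | c ≠ 0}` for the `T` of the lift identity
(★ `twistedTraceSet_eq_image_smul`): every OTHER «choice of `π̃(ε)`» multiplies the identity `χ_{π̃ε}(φ) = χ_Π(f)` by a constant `c ≠ 1`.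
[cite: Rogawski1990, §13.2 p. 200; §4.10 p. 57] [cite: Bump1997, Prop. 4.2.4 p. 428] -/
theorem IsTwistedCharLiftWith.exists_line (h : IsTwistedCharLiftWith Φ T𝔯 𝔩 νG νGt P πt)
    {K : Subgroup (GtLoc L v)} (hKo : IsOpen (K : Set (GtLoc L v))) (hKc : IsCompact (K : Set (GtLoc L v))) :
    ∃ T : (GtLoc L v → ℂ) → ℂ, (∀ φ f, IsLocSmooth φ → IsLocSmooth f → T𝔯 φ f → T φ = chiPacket 𝔩 νG P f) ∧
      twistedTraceSet πt νGt (cmTwistLocalEquiv L 3 Φ hΦ v) = (fun c : ℂ => c • T) '' {c : ℂ | c ≠ 0} := by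
  obtain ⟨hcls, T, hT, hid⟩ := (isTwistedCharLiftWith_iff_cmTwistLocalEquiv hΦ).1 h
  exact ⟨T, hid, twistedTraceSet_eq_image_smul hcls.isAdmissible hKo hKc νGt hT⟩

/-- **A second member of `twistedTraceSet` satisfies the identity up to ONE scalar**: if `π̃` is a lift of `Π` with matched character `T`
and `T′` is any twisted character of `π̃` along `cmTwistLocalEquiv`, then for some `c ≠ 0`, `T′ φ = c · χ_Π(f)` on all smooth `T𝔯`-pairs.
[cite: Rogawski1990, §13.2 p. 200; §4.10 p. 57] -/
theorem IsTwistedCharLiftWith.exists_smul_of_mem (h : IsTwistedCharLiftWith Φ T𝔯 𝔩 νG νGt P πt)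
    {K : Subgroup (GtLoc L v)} (hKo : IsOpen (K : Set (GtLoc L v))) (hKc : IsCompact (K : Set (GtLoc L v)))
    {T' : (GtLoc L v → ℂ) → ℂ} (hT' : T' ∈ twistedTraceSet πt νGt (cmTwistLocalEquiv L 3 Φ hΦ v)) :
    ∃ c : ℂ, c ≠ 0 ∧ ∀ φ f, IsLocSmooth φ → IsLocSmooth f → T𝔯 φ f → T' φ = c * chiPacket 𝔩 νG P f := by
  obtain ⟨hcls, T, hT, hid⟩ := (isTwistedCharLiftWith_iff_cmTwistLocalEquiv hΦ).1 h
  obtain ⟨c, hc, rfl⟩ := twistedTraceSet_pairwise_smul hcls.isAdmissible hKo hKc νGt hT hT'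
  exact ⟨c, hc, fun φ f hφ hf hr => by rw [Pi.smul_apply, smul_eq_mul, hid φ f hφ hf hr]⟩

end Hermitian

end Summit.HodgeConjecture.HodgeConjecture.R90.S4

end
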